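import Summits.RiemannHypothesis.RiemannHypothesis.Theses.RuelleBand
import Summits.RiemannHypothesis.RiemannHypothesis.Theorems.RuelleBandAsymptoticCriticalLineSplit
import Literature.Barriers.RiemannHypothesis.LindelofBacklundProofs
import Literature.NumberTheory.LFunctions.VinogradovKorobovLemma45

/-!
# `AsymptoticCriticalLine` (crux stmt-RiemannHypothesis-2063): the interior half alone is Lindelöf-hard

Support file of the line `interior-edge-split` (lead prover-line-stmt-RiemannHypothesis-2063-0).
CALIBRATION of the line's stub 1 ("no right-interior band": every `σ₀ ∈ (1/2, 1)` has a vertical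
neighbourhood `|Re s − σ₀| < ε` with finitely many zeros of `ζ`): together with ANY Richert-type bound
`|ζ(σ + it)| ≤ A |t|^{B(1−σ)^{3/2}} log^{2/3}|t|` (`Literature.NumberTheory.LFunctions.RichertBound A B`;
Richert 1967, Ford 2002 Thm 1 gives `(A, B) = (76.2, 4.45)`) it implies BACKLUND's zero condition
`N(σ, T+1) − N(σ, T) = o(log T)` for every `σ > 1/2`
(`Literature.Barriers.RiemannHypothesis.BacklundZeroCondition`), hence the LINDELÖF HYPOTHESIS by
Titchmarsh's Theorem 13.5 (PROVED in tree, `Titchmarsh1986_thm13_5_holds`):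

* `backlundZeroCondition_of_noRightInteriorBand` : `RichertBound A B → (stub 1) → BacklundZeroCondition`;
* `lindelofHypothesis_of_noRightInteriorBand` : `RichertBound A B → (stub 1) → LindelofHypothesis`.

So the Lindelöf content of the crux (`Negative`: `ACL ⟹ Backlund ⟹ LH`) sits ENTIRELY in the interior
half of the split `ACL ⟺ (stub 1) ∧ Strip.StripZeroFreeStrip`
(`InteriorEdgeSplit.acl_iff_noRightInteriorBand_and_strip`); the edge half (a zero-free strip at
`σ = 1`) is not known to imply LH.  Barrier reading (`Literature.Barriers.RiemannHypothesis.LindelofBacklund`):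
size/moment methods top out at LH ⟺ Backlund, which is strictly weaker than stub 1 (Backlund allows
infinitely many zeros near `σ₀ = 3/4` placed sparsely in height), so a claimed proof of stub 1 that does
not visibly pass Lindelöf strength is suspect.

## Proof (numbers, not adjectives)

Fix `σ > 1/2` and `c > 0`; normalise the Richert constants to `A ≥ 6`, `B ≥ 0`
(`richertBound_max_six`).  Put `R := min (1/4) (c / (17 (B + 1)))²`, `h := R/2`.
(i) INTERIOR PART.  By compactness (`InteriorEdgeSplit.exists_im_le_of_noRightInteriorBand`, cover of
`[σ, 1 − h] ⊂ (1/2, 1)` by finitely many finite-zero neighbourhoods) the zeros with `σ ≤ Re ρ ≤ 1 − h`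
have bounded height `≤ T₀`; for `T ≥ T₀` none of them lies in the window `T < Im ρ ≤ T + 1`.
(ii) EDGE PART.  The zeros with `1 − h < Re ρ ≤ 1`, `T < Im ρ ≤ T + 1` are covered by the
`⌊1/h⌋ + 1 ≤ 3/R` discs `|1 + i t_k − ρ| ≤ R`, `t_k = T + k h` (`h² + h² ≤ R²`), and on each disc
Mossinghoff–Trudgian–Yang's Lemma 4.5 = Ford's Lemma 4.2 (PROVED in tree, `mty_lemma_4_5`) counts, with
multiplicity, `N(t_k, R) ≤ 1.3478 R^{3/2} B log t_k + 3.777 + (log A − log R + (2/3) log log t_k)/1.879`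
(`t_k ≥ 100`).  Summing: `≤ 4.05 B R^{1/2} log(T+1) + (3/R)(3.777 + (log A − log R)/1.879)
+ (1.07/R) log log(T+1)`; with `log(T+1) ≤ 2 log T` the first term is `≤ (8.1 B /(17(B+1))) c log T
< (c/2) log T`, and the rest is `O_R(log log T) ≤ (c/2) log T` eventually.  The superlinear exponent
`(1−σ)^{3/2}` is what makes the disc count `o(log T)` as `R → 0`: with a linear exponent `B(1−σ)` the
same computation gives `≍ B log T` per unit window, not `o(log T)`.
-/

noncomputable section

namespace Summit.RiemannHypothesis.RiemannHypothesis.Theorems.AsymptoticCriticalLine.InteriorEdgeSplit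

open Complex Filter Topology Asymptotics Metric Set
open Literature.NumberTheory.LFunctions
open Literature.Barriers.RiemannHypothesis (BacklundZeroCondition Titchmarsh1986_thm13_5_holds)

/-- A point with `1 − R/2 < Re ρ ≤ 1` and `|Im ρ − τ| ≤ R/2` lies in Ford's disc `‖1 + iτ − ρ‖ ≤ R`. -/
theorem norm_one_add_mul_I_sub_le {R τ : ℝ} (hR : 0 < R) {ρ : ℂ} (h1 : 1 - R / 2 < ρ.re) (h2 : ρ.re ≤ 1)
    (h3 : |ρ.im - τ| ≤ R / 2) : ‖1 + τ * I - ρ‖ ≤ R := by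
  rw [← sq_le_sq₀ (norm_nonneg _) hR.le, Complex.sq_norm, Complex.normSq_apply]
  simp only [sub_re, add_re, one_re, mul_re, ofReal_re, I_re, mul_zero, ofReal_im, I_im, mul_one,
    sub_self, add_zero, sub_im, add_im, one_im, mul_im, zero_add]
  have h4 : (τ - ρ.im) * (τ - ρ.im) ≤ (R / 2) * (R / 2) := by
    have := abs_le.1 h3
    nlinarith
  nlinarith

/-- **EDGE COUNT** (the analytic input). Under `RichertBound A B` (`A ≥ 6`, `B ≥ 0`), for
`0 < R ≤ 1/4` and `T ≥ 100`, any finite set `F` of zeros of `ζ` in the edge part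
`1 − R/2 < Re ρ ≤ 1`, `T < Im ρ ≤ T + 1` of a unit window has total multiplicity
`≤ (⌊2/R⌋ + 1) · (1.3478 R^{3/2} B log(T+1) + 3.777 + (log A − log R + (2/3) log log(T+1))/1.879)`:
cover the window by the discs `‖1 + i(T + kR/2) − ρ‖ ≤ R`, `k ≤ ⌊2/R⌋` (`norm_one_add_mul_I_sub_le`,
`exists_index_of_mem_Ioc`) and apply Mossinghoff–Trudgian–Yang's Lemma 4.5 = Ford's Lemma 4.2
(`mty_lemma_4_5`, PROVED in tree) on each disc. -/
theorem edge_window_sum_le {A B : ℝ} (hA : 6 ≤ A) (hB : 0 ≤ B) (hRB : RichertBound A B)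
    {R : ℝ} (hR0 : 0 < R) (hR4 : R ≤ 1 / 4) {T : ℝ} (hT : 100 ≤ T) (F : Finset ℂ)
    (hF : ∀ ρ ∈ F, riemannZeta ρ = 0 ∧ 1 - R / 2 < ρ.re ∧ ρ.re ≤ 1 ∧ T < ρ.im ∧ ρ.im ≤ T + 1) :
    ∑ ρ ∈ F, (riemannZetaZeroOrder ρ : ℝ) ≤
      ((⌊1 / (R / 2)⌋₊ : ℝ) + 1) * (1.3478 * R ^ (3 / 2 : ℝ) * B * Real.log (T + 1) + 3.777
          + (Real.log A - Real.log R + 2 / 3 * Real.log (Real.log (T + 1))) / 1.879) := by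
  classical
  have hh0 : 0 < R / 2 := by positivity
  set K : ℕ := ⌊1 / (R / 2)⌋₊ with hK
  set Dk : ℕ → Finset ℂ := fun k ↦ fordNearZeros (T + k * (R / 2)) R with hDk
  -- cover
  have hcover : ∀ ρ ∈ F, ∃ k ∈ Finset.range (K + 1), ρ ∈ Dk k := by
    intro ρ hρ
    obtain ⟨hz, h1ρ, h2ρ, hTρ, hTρ'⟩ := hF ρ hρ
    obtain ⟨k, hk, hkγ⟩ := exists_index_of_mem_Ioc hh0 hTρ hTρ'
    exact ⟨k, hk, mem_fordNearZeros.2 ⟨hz, norm_one_add_mul_I_sub_le hR0 h1ρ h2ρ hkγ⟩⟩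
  -- per disc: MTY Lemma 4.5
  have hdisc : ∀ k ∈ Finset.range (K + 1),
      ∑ ρ ∈ F.filter (· ∈ Dk k), (riemannZetaZeroOrder ρ : ℝ) ≤
        1.3478 * R ^ (3 / 2 : ℝ) * B * Real.log (T + 1) + 3.777
          + (Real.log A - Real.log R + 2 / 3 * Real.log (Real.log (T + 1))) / 1.879 := by
    intro k hk
    rw [Finset.mem_range, Nat.lt_add_one_iff] at hk
    have hk' : (k : ℝ) ≤ K := by exact_mod_cast hk
    have hfl : (K : ℝ) ≤ 1 / (R / 2) := Nat.floor_le (by positivity)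
    have hkh : (k : ℝ) * (R / 2) ≤ 1 := by
      have : (k : ℝ) ≤ 1 / (R / 2) := hk'.trans hfl
      rwa [le_div_iff₀ hh0] at this
    have hk0 : (0 : ℝ) ≤ k * (R / 2) := by positivity
    have hτT' : T + k * (R / 2) ≤ T + 1 := by linarith
    have hτ100 : 100 ≤ T + k * (R / 2) := by linarith
    have hle : ∑ ρ ∈ F.filter (· ∈ Dk k), (riemannZetaZeroOrder ρ : ℝ) ≤ fordN (T + k * (R / 2)) R := by
      rw [fordN]
      refine Finset.sum_le_sum_of_subset_of_nonneg (fun ρ hρ => (Finset.mem_filter.1 hρ).2)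
        fun ρ hρ _ ↦ ?_
      rw [mem_fordNearZeros] at hρ
      exact_mod_cast riemannZetaZeroOrder_nonneg (ne_one_of_riemannZeta_eq_zero hρ.1)
    have h45 := mty_lemma_4_5 hA hB hRB hτ100 hR0 hR4
    have hlogτ : Real.log (T + k * (R / 2)) ≤ Real.log (T + 1) :=
      Real.log_le_log (by linarith) hτT'
    have hlogτ0 : 0 < Real.log (T + k * (R / 2)) := Real.log_pos (by linarith)
    have hllτ : Real.log (Real.log (T + k * (R / 2))) ≤ Real.log (Real.log (T + 1)) :=
      Real.log_le_log hlogτ0 hlogτ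
    have hRB0 : 0 ≤ 1.3478 * R ^ (3 / 2 : ℝ) * B := by positivity
    have h3 := mul_le_mul_of_nonneg_left hlogτ hRB0
    have h2 : (Real.log A - Real.log R + 2 / 3 * Real.log (Real.log (T + k * (R / 2)))) / 1.879 ≤
        (Real.log A - Real.log R + 2 / 3 * Real.log (Real.log (T + 1))) / 1.879 :=
      div_le_div_of_nonneg_right (by linarith) (by norm_num)
    linarith
  -- superpose the discs
  have hnn : ∀ ρ ∈ F, (0 : ℝ) ≤ riemannZetaZeroOrder ρ := fun ρ hρ ↦
    Int.cast_nonneg (riemannZetaZeroOrder_nonneg (ne_one_of_riemannZeta_eq_zero (hF ρ hρ).1))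
  have hsum : ∑ ρ ∈ F, (riemannZetaZeroOrder ρ : ℝ) ≤
      ∑ k ∈ Finset.range (K + 1), ∑ ρ ∈ F.filter (· ∈ Dk k), (riemannZetaZeroOrder ρ : ℝ) := by
    calc ∑ ρ ∈ F, (riemannZetaZeroOrder ρ : ℝ)
        ≤ ∑ ρ ∈ F, ∑ k ∈ Finset.range (K + 1),
            (if ρ ∈ Dk k then (riemannZetaZeroOrder ρ : ℝ) else 0) := by
          refine Finset.sum_le_sum fun ρ hρ ↦ ?_
          obtain ⟨k, hk, hρk⟩ := hcover ρ hρ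
          have := Finset.single_le_sum (s := Finset.range (K + 1))
            (f := fun k ↦ if ρ ∈ Dk k then (riemannZetaZeroOrder ρ : ℝ) else 0)
            (fun j _ ↦ by
              by_cases hj : ρ ∈ Dk j
              · simp only [hj, if_true]; exact hnn ρ hρ
              · simp only [hj, if_false]; exact le_rfl) hk
          simpa only [hρk, if_true] using this
      _ = ∑ k ∈ Finset.range (K + 1), ∑ ρ ∈ F,
            (if ρ ∈ Dk k then (riemannZetaZeroOrder ρ : ℝ) else 0) := Finset.sum_comm
      _ = ∑ k ∈ Finset.range (K + 1), ∑ ρ ∈ F.filter (· ∈ Dk k),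
            (riemannZetaZeroOrder ρ : ℝ) := by
          refine Finset.sum_congr rfl fun k _ ↦ ?_
          rw [Finset.sum_filter]
  calc ∑ ρ ∈ F, (riemannZetaZeroOrder ρ : ℝ)
      ≤ ∑ k ∈ Finset.range (K + 1), ∑ ρ ∈ F.filter (· ∈ Dk k), (riemannZetaZeroOrder ρ : ℝ) := hsum
    _ ≤ ∑ k ∈ Finset.range (K + 1), (1.3478 * R ^ (3 / 2 : ℝ) * B * Real.log (T + 1) + 3.777
          + (Real.log A - Real.log R + 2 / 3 * Real.log (Real.log (T + 1))) / 1.879) :=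
        Finset.sum_le_sum hdisc
    _ = ((K : ℝ) + 1) * (1.3478 * R ^ (3 / 2 : ℝ) * B * Real.log (T + 1) + 3.777
          + (Real.log A - Real.log R + 2 / 3 * Real.log (Real.log (T + 1))) / 1.879) := by
        rw [Finset.sum_const, Finset.card_range, nsmul_eq_mul]; push_cast; ring



/-- A Richert-type bound stays true with larger constants: `RichertBound A B → RichertBound (max A 6) (max B 0)`
(the factor `|t|^{B(1−σ)^{3/2}} log^{2/3}|t|` is `≥ 0` and monotone in `B` for `|t| ≥ 3`). The normal form
`A ≥ 6`, `B ≥ 0` is the one consumed by `mty_lemma_4_5`. -/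
theorem richertBound_max_six {A B : ℝ} (h : RichertBound A B) : RichertBound (max A 6) (max B 0) := by
  intro σ t ht h1 h2
  refine (h σ t ht h1 h2).trans ?_
  have ht1 : 1 ≤ |t| := by linarith
  have hx : 0 ≤ (1 - σ) ^ (3 / 2 : ℝ) := Real.rpow_nonneg (by linarith) _
  have hlog : 0 ≤ Real.log |t| := Real.log_nonneg ht1
  have hL : 0 ≤ Real.log |t| ^ (2 / 3 : ℝ) := Real.rpow_nonneg hlog _
  have hP : |t| ^ (B * (1 - σ) ^ (3 / 2 : ℝ)) ≤ |t| ^ (max B 0 * (1 - σ) ^ (3 / 2 : ℝ)) :=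
    Real.rpow_le_rpow_of_exponent_le ht1 (mul_le_mul_of_nonneg_right (le_max_left _ _) hx)
  have hP0 : 0 ≤ |t| ^ (B * (1 - σ) ^ (3 / 2 : ℝ)) := Real.rpow_nonneg (abs_nonneg t) _
  have hP0' : 0 ≤ |t| ^ (max B 0 * (1 - σ) ^ (3 / 2 : ℝ)) := Real.rpow_nonneg (abs_nonneg t) _
  have hfac : |t| ^ (B * (1 - σ) ^ (3 / 2 : ℝ)) * Real.log |t| ^ (2 / 3 : ℝ) ≤
      |t| ^ (max B 0 * (1 - σ) ^ (3 / 2 : ℝ)) * Real.log |t| ^ (2 / 3 : ℝ) :=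
    mul_le_mul_of_nonneg_right hP hL
  have hb0 : 0 ≤ |t| ^ (B * (1 - σ) ^ (3 / 2 : ℝ)) * Real.log |t| ^ (2 / 3 : ℝ) := mul_nonneg hP0 hL
  have hb0' : 0 ≤ |t| ^ (max B 0 * (1 - σ) ^ (3 / 2 : ℝ)) * Real.log |t| ^ (2 / 3 : ℝ) :=
    mul_nonneg hP0' hL
  have h6 : (0 : ℝ) ≤ max A 6 := le_trans (by norm_num) (le_max_right _ _)
  calc A * |t| ^ (B * (1 - σ) ^ (3 / 2 : ℝ)) * Real.log |t| ^ (2 / 3 : ℝ)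
      = A * (|t| ^ (B * (1 - σ) ^ (3 / 2 : ℝ)) * Real.log |t| ^ (2 / 3 : ℝ)) := by ring
    _ ≤ max A 6 * (|t| ^ (max B 0 * (1 - σ) ^ (3 / 2 : ℝ)) * Real.log |t| ^ (2 / 3 : ℝ)) := by
        rcases le_or_gt 0 A with hA | hA
        · exact mul_le_mul (le_max_left _ _) hfac hb0 h6
        · exact (mul_nonpos_of_nonpos_of_nonneg hA.le hb0).trans (mul_nonneg h6 hb0')
    _ = _ := by ring

/-- The number of covering discs: `⌊2/R⌋ + 1 ≤ 3/R` for `0 < R ≤ 1`. -/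
theorem floor_add_one_le_three_div {R : ℝ} (hR0 : 0 < R) (hR1 : R ≤ 1) :
    ((⌊1 / (R / 2)⌋₊ : ℝ) + 1) ≤ 3 / R := by
  have hfl : (⌊1 / (R / 2)⌋₊ : ℝ) ≤ 1 / (R / 2) := Nat.floor_le (by positivity)
  have h1 : (1 : ℝ) ≤ 1 / R := by rw [le_div_iff₀ hR0]; linarith
  have h2 : 1 / (R / 2) = 2 / R := by field_simp
  have h3 : 2 / R + 1 / R = 3 / R := by ring
  linarith

/-- The radius: for `B ≥ 0` and `c > 0` there is `0 < R ≤ 1/4` with `6 · 1.3478 · B · √R ≤ c/2`. -/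
theorem exists_radius {B c : ℝ} (hB : 0 ≤ B) (hc : 0 < c) :
    ∃ R : ℝ, 0 < R ∧ R ≤ 1 / 4 ∧ 6 * 1.3478 * B * Real.sqrt R ≤ c / 2 := by
  set q : ℝ := c / (17 * (B + 1)) with hq
  have hq0 : 0 < q := by positivity
  refine ⟨min (1 / 4) (q ^ 2), lt_min (by norm_num) (by positivity), min_le_left _ _, ?_⟩
  have hsq : Real.sqrt (min (1 / 4) (q ^ 2)) ≤ q := (Real.sqrt_le_left hq0.le).2 (min_le_right _ _)
  have h0 : 0 ≤ 6 * 1.3478 * B := by positivity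
  have hX : 6 * 1.3478 * B / (17 * (B + 1)) ≤ 1 / 2 := by
    rw [div_le_iff₀ (by positivity)]
    linarith
  have e : 6 * 1.3478 * B * q = c * (6 * 1.3478 * B / (17 * (B + 1))) := by
    rw [hq]; ring
  have h4 : 6 * 1.3478 * B * q ≤ c / 2 := by
    rw [e]
    have := mul_le_mul_of_nonneg_left hX hc.le
    linarith
  exact (mul_le_mul_of_nonneg_left hsq h0).trans h4

/-- The lower-order terms of the disc counts are `o(log T)`. -/
theorem lowerOrder_isLittleO (C₁ C₂ : ℝ) :
    (fun T : ℝ => C₁ + C₂ * Real.log (Real.log (T + 1))) =o[atTop] Real.log := by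
  have hlogT : Tendsto (fun T : ℝ => ‖Real.log T‖) atTop atTop :=
    tendsto_norm_atTop_atTop.comp Real.tendsto_log_atTop
  have hc₁ : (fun _ : ℝ => C₁) =o[atTop] Real.log := isLittleO_const_left.2 (Or.inr hlogT)
  have hT1 : Tendsto (fun T : ℝ => Real.log (T + 1)) atTop atTop :=
    Real.tendsto_log_atTop.comp (tendsto_atTop_add_const_right atTop 1 tendsto_id)
  have hll : (fun T : ℝ => Real.log (Real.log (T + 1))) =o[atTop] fun T : ℝ => Real.log (T + 1) :=
    Real.isLittleO_log_id_atTop.comp_tendsto hT1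
  have hl2 : (fun T : ℝ => Real.log (T + 1)) =O[atTop] Real.log := by
    refine IsBigO.of_bound 2 ?_
    filter_upwards [eventually_ge_atTop (2 : ℝ)] with T hT
    have hT0 : 0 < T := by linarith
    rw [Real.norm_of_nonneg (Real.log_nonneg (by linarith)),
      Real.norm_of_nonneg (Real.log_nonneg (by linarith))]
    rw [← Real.log_rpow hT0, Real.rpow_two]
    exact Real.log_le_log (by linarith) (by nlinarith)
  exact hc₁.add ((hll.trans_isBigO hl2).const_mul_left C₂)

/-- **The interior half of the crux is Lindelöf-hard, I: Backlund's zero condition.** If `ζ` obeys a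
Richert-type bound `RichertBound A B` (any constants) and the real parts of its zeros do not accumulate at
any `σ₀ ∈ (1/2, 1)` (the line's stub `stub_noRightInteriorBand`, verbatim), then for every `σ > 1/2`,
`N(σ, T+1) − N(σ, T) = o(log T)` (`Literature.Barriers.RiemannHypothesis.BacklundZeroCondition`).
Interior slabs are eventually empty by compactness; the edge `1 − R/2 < Re ρ ≤ 1` of the window is counted
by MTY Lemma 4.5 / Ford Lemma 4.2 (`mty_lemma_4_5`) on `≤ 3/R` discs (`edge_window_sum_le`), giving
`≤ 6·1.3478·B·R^{1/2} log T + O_R(log log T)`, and `R → 0`. -/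
theorem backlundZeroCondition_of_noRightInteriorBand {A B : ℝ} (hRB : RichertBound A B)
    (h1 : ∀ σ₀ : ℝ, 1 / 2 < σ₀ → σ₀ < 1 →
      ∃ ε : ℝ, 0 < ε ∧ {s : ℂ | riemannZeta s = 0 ∧ 0 < s.re ∧ s.re < 1 ∧ |s.re - σ₀| < ε}.Finite) :
    BacklundZeroCondition := by
  classical
  have hR' := richertBound_max_six hRB
  have hA6 : (6 : ℝ) ≤ max A 6 := le_max_right _ _
  have hB0 : (0 : ℝ) ≤ max B 0 := le_max_right _ _
  generalize max A 6 = A' at hR' hA6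
  generalize max B 0 = B' at hR' hB0
  intro σ hσ
  rw [isLittleO_iff]
  intro c hc
  -- the radius, the number of discs, the height beyond which the interior slab is empty
  obtain ⟨R, hR0, hR4, hRc⟩ := exists_radius hB0 hc
  have hR1 : R ≤ 1 := hR4.trans (by norm_num)
  have hK := floor_add_one_le_three_div hR0 hR1
  obtain ⟨T₀, hT₀⟩ := exists_im_le_of_noRightInteriorBand h1 (a := σ) (b := 1 - R / 2) hσ (by linarith)
  -- the lower-order terms
  have hlogA : 0 ≤ Real.log A' := Real.log_nonneg (by linarith)
  have hlogR : Real.log R ≤ 0 := Real.log_nonpos hR0.le hR1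
  have hlow := (lowerOrder_isLittleO (3 / R * (3.777 + (Real.log A' - Real.log R) / 1.879))
    (3 / R * (2 / 3 / 1.879))).def (c := c / 2) (by positivity)
  filter_upwards [eventually_ge_atTop T₀, eventually_ge_atTop (100 : ℝ), hlow] with T hT₀T hT100 hTlow
  have hT0 : 0 < T := by linarith
  have hlogT1 : 1 ≤ Real.log T := by
    rw [← Real.log_exp 1]
    exact Real.log_le_log (Real.exp_pos 1) (by have := Real.exp_one_lt_d9; linarith)
  have hlogT2 : Real.log (T + 1) ≤ 2 * Real.log T := by
    rw [← Real.log_rpow hT0, Real.rpow_two]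
    exact Real.log_le_log (by linarith) (by nlinarith)
  have hlogT10 : Real.log T ≤ Real.log (T + 1) := Real.log_le_log hT0 (by linarith)
  have hll0 : 0 ≤ Real.log (Real.log (T + 1)) := Real.log_nonneg (by linarith)
  -- the norms and the window
  rw [Real.norm_eq_abs, Real.norm_eq_abs, abs_of_nonneg (zetaZeroCountRe_sub_nonneg σ (by linarith)),
    abs_of_pos (by linarith), zetaZeroCountRe_sub_eq_sum σ (by linarith : T ≤ T + 1)]
  set F := (zetaZeroBox_finite σ (T + 1)).toFinset \ (zetaZeroBox_finite σ T).toFinset with hF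
  -- every zero of the window is an EDGE zero (the slab `σ ≤ Re ρ ≤ 1 - R/2` is empty beyond `T₀`)
  have hF' : ∀ ρ ∈ F, riemannZeta ρ = 0 ∧ 1 - R / 2 < ρ.re ∧ ρ.re ≤ 1 ∧ T < ρ.im ∧ ρ.im ≤ T + 1 := by
    intro ρ hρ
    obtain ⟨hz, hσρ, h1ρ, hTρ, hTρ'⟩ := mem_sdiff_zetaZeroBox hρ
    refine ⟨hz, ?_, h1ρ, hTρ, hTρ'⟩
    by_contra hle
    have := hT₀ ρ hz hσρ (not_lt.1 hle)
    linarith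
  have hedge := edge_window_sum_le hA6 hB0 hR' hR0 hR4 hT100 F hF'
  -- arithmetic
  have hR32 : R ^ (3 / 2 : ℝ) = R * Real.sqrt R := by
    rw [show (3 / 2 : ℝ) = 1 + 1 / 2 by norm_num, Real.rpow_add hR0, Real.rpow_one,
      Real.sqrt_eq_rpow]
  have hX0 : 0 ≤ 1.3478 * R ^ (3 / 2 : ℝ) * B' * Real.log (T + 1) := by
    have : 0 ≤ Real.log (T + 1) := by linarith
    positivity
  have hY0 : 0 ≤ 3.777 + (Real.log A' - Real.log R + 2 / 3 * Real.log (Real.log (T + 1))) / 1.879 := by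
    have : 0 ≤ Real.log A' - Real.log R + 2 / 3 * Real.log (Real.log (T + 1)) := by linarith
    positivity
  -- leading term
  have hlead : 3 / R * (1.3478 * R ^ (3 / 2 : ℝ) * B' * Real.log (T + 1)) ≤ c / 2 * Real.log T := by
    have e : 3 / R * (1.3478 * R ^ (3 / 2 : ℝ) * B' * Real.log (T + 1)) =
        3 * 1.3478 * B' * Real.sqrt R * Real.log (T + 1) := by
      rw [hR32, show 3 / R * (1.3478 * (R * Real.sqrt R) * B' * Real.log (T + 1)) =
          R / R * (3 * 1.3478 * B' * Real.sqrt R * Real.log (T + 1)) by ring, div_self hR0.ne', one_mul]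
    rw [e]
    have h0 : 0 ≤ 3 * 1.3478 * B' * Real.sqrt R := by positivity
    calc 3 * 1.3478 * B' * Real.sqrt R * Real.log (T + 1)
        ≤ 3 * 1.3478 * B' * Real.sqrt R * (2 * Real.log T) := mul_le_mul_of_nonneg_left hlogT2 h0
      _ = 6 * 1.3478 * B' * Real.sqrt R * Real.log T := by ring
      _ ≤ c / 2 * Real.log T := mul_le_mul_of_nonneg_right hRc (by linarith)
  -- lower-order term
  have hlow2 : 3 / R * (3.777 + (Real.log A' - Real.log R + 2 / 3 * Real.log (Real.log (T + 1))) / 1.879)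
      ≤ c / 2 * Real.log T := by
    have e : 3 / R * (3.777 + (Real.log A' - Real.log R + 2 / 3 * Real.log (Real.log (T + 1))) / 1.879) =
        3 / R * (3.777 + (Real.log A' - Real.log R) / 1.879)
          + 3 / R * (2 / 3 / 1.879) * Real.log (Real.log (T + 1)) := by ring
    rw [e]
    have h := hTlow
    have hpos : 0 ≤ 3 / R * (3.777 + (Real.log A' - Real.log R) / 1.879)
        + 3 / R * (2 / 3 / 1.879) * Real.log (Real.log (T + 1)) := by
      have : 0 ≤ Real.log A' - Real.log R := by linarith
      positivity
    rw [Real.norm_of_nonneg hpos, Real.norm_of_nonneg (by linarith : (0 : ℝ) ≤ Real.log T)] at h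
    exact h
  -- conclude
  have hK0 : (0 : ℝ) ≤ (⌊1 / (R / 2)⌋₊ : ℝ) + 1 := by positivity
  calc ∑ ρ ∈ F, (riemannZetaZeroOrder ρ : ℝ)
      ≤ ((⌊1 / (R / 2)⌋₊ : ℝ) + 1) * (1.3478 * R ^ (3 / 2 : ℝ) * B' * Real.log (T + 1) + 3.777
          + (Real.log A' - Real.log R + 2 / 3 * Real.log (Real.log (T + 1))) / 1.879) := hedge
    _ ≤ 3 / R * (1.3478 * R ^ (3 / 2 : ℝ) * B' * Real.log (T + 1) + 3.777
          + (Real.log A' - Real.log R + 2 / 3 * Real.log (Real.log (T + 1))) / 1.879) :=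
        mul_le_mul_of_nonneg_right hK (by linarith)
    _ = 3 / R * (1.3478 * R ^ (3 / 2 : ℝ) * B' * Real.log (T + 1))
          + 3 / R * (3.777 + (Real.log A' - Real.log R + 2 / 3 * Real.log (Real.log (T + 1))) / 1.879) := by
        ring
    _ ≤ c / 2 * Real.log T + c / 2 * Real.log T := add_le_add hlead hlow2
    _ = c * Real.log T := by ring

/-- **The interior half of the crux is Lindelöf-hard, II: the Lindelöf hypothesis.** Under any
Richert-type bound, "no right-interior band" (the line's stub 1) implies the Lindelöf hypothesis
`ζ(1/2 + it) = O(t^ε)` (`Literature.NumberTheory.LFunctions.LindelofHypothesis`), by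
`backlundZeroCondition_of_noRightInteriorBand` and Titchmarsh's Theorem 13.5 (PROVED in tree,
`Literature.Barriers.RiemannHypothesis.Titchmarsh1986_thm13_5_holds`). Ford's Theorem 1
(`zeta_bound_ford`, i.e. `RichertBound 76.2 4.45` via `richertBound_ford`) discharges the first hypothesis. -/
theorem lindelofHypothesis_of_noRightInteriorBand {A B : ℝ} (hRB : RichertBound A B)
    (h1 : ∀ σ₀ : ℝ, 1 / 2 < σ₀ → σ₀ < 1 →
      ∃ ε : ℝ, 0 < ε ∧ {s : ℂ | riemannZeta s = 0 ∧ 0 < s.re ∧ s.re < 1 ∧ |s.re - σ₀| < ε}.Finite) :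
    LindelofHypothesis :=
  Titchmarsh1986_thm13_5_holds.2 (backlundZeroCondition_of_noRightInteriorBand hRB h1)

/-- … in particular under FORD's Theorem 1 (`zeta_bound_ford`: `|ζ(σ+it)| ≤ 76.2 t^{4.45(1−σ)^{3/2}} log^{2/3} t`,
the named fact of `VinogradovKorobovInputs.lean`, i.e. `RichertBound 76.2 4.45` via `richertBound_ford`):
stub 1 and Ford's bound give the Lindelöf hypothesis. -/
theorem lindelofHypothesis_of_noRightInteriorBand_of_ford (hF : zeta_bound_ford)
    (h1 : ∀ σ₀ : ℝ, 1 / 2 < σ₀ → σ₀ < 1 →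
      ∃ ε : ℝ, 0 < ε ∧ {s : ℂ | riemannZeta s = 0 ∧ 0 < s.re ∧ s.re < 1 ∧ |s.re - σ₀| < ε}.Finite) :
    LindelofHypothesis :=
  lindelofHypothesis_of_noRightInteriorBand (richertBound_ford hF) h1

/-- **Registered sub-goal `interiorImpliesBacklund`** of crux stmt-RiemannHypothesis-2063 (periphery of
line `interior-edge-split`; the planner's calibration `InteriorImpliesBacklund`, now a theorem): for ALL
Richert constants `A, B`, `RichertBound A B` and "no right-interior band" (stub 1 verbatim) imply
Backlund's zero condition. -/
theorem interiorImpliesBacklund :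
    ∀ A B : ℝ, Literature.NumberTheory.LFunctions.RichertBound A B →
      (∀ σ₀ : ℝ, 1 / 2 < σ₀ → σ₀ < 1 →
        ∃ ε : ℝ, 0 < ε ∧ {s : ℂ | riemannZeta s = 0 ∧ 0 < s.re ∧ s.re < 1 ∧ |s.re - σ₀| < ε}.Finite) →
      Literature.Barriers.RiemannHypothesis.BacklundZeroCondition :=
  fun _ _ hRB h1 => backlundZeroCondition_of_noRightInteriorBand hRB h1

/-- … and the Lindelöf hypothesis (Titchmarsh's Theorem 13.5, proved in tree). -/
theorem interiorImpliesLindelof :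
    ∀ A B : ℝ, Literature.NumberTheory.LFunctions.RichertBound A B →
      (∀ σ₀ : ℝ, 1 / 2 < σ₀ → σ₀ < 1 →
        ∃ ε : ℝ, 0 < ε ∧ {s : ℂ | riemannZeta s = 0 ∧ 0 < s.re ∧ s.re < 1 ∧ |s.re - σ₀| < ε}.Finite) →
      Literature.NumberTheory.LFunctions.LindelofHypothesis :=
  fun _ _ hRB h1 => lindelofHypothesis_of_noRightInteriorBand hRB h1

end Summit.RiemannHypothesis.RiemannHypothesis.Theorems.AsymptoticCriticalLine.InteriorEdgeSplit

end
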